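import Summits.NavierStokesRegularity.FluidComputer.AbcCrayaMatrix
import Summits.NavierStokesRegularity.FluidComputer.SkewCutGalerkinFromSections
import Summits.NavierStokesRegularity.FluidComputer.SkewCutGalerkinLattice
import Summits.NavierStokesRegularity.FluidComputer.AbcLatticePairingBound

/-!
# ASSEMBLY of the skew-cut X0 chain for the full linearised ABC operator in Craya coordinates
(instab3 g5 — implementation 1 of the skew-cut X0 certifier, cell `ns-blowup`, 2026-08-26)

HONEST FRAMING (human ruling D-0035): nothing here is a claim about Navier–Stokes blow-up.
WHAT THIS IS NOT: not NS evidence; MODEL lane; no certificate is used or moved by this file. It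
instantiates the abstract end-to-end theorem of the X0 chain,
`SkewCutGalerkinFromSections.exists_smooth_eigenvector_Ioo_of_sections'` (instab4 g4), on the Craya
index set `CrayaIdx` with the certifier's matrix `abcCrayaMatrix A B C` (implementation 1's
coordinates), discharging every STRUCTURAL hypothesis of HOME/instab4/KERNEL-CHAIN.md §2 for the
full (class-free) operator:
(A1) levels `ℓ_i = −ν|k_i|²` and the resolvent-symbol identities; (A2) band `crayaNbr` (width
`W = 12`, symmetric), growth `‖A_{ij}‖ ≤ K w_j` with `K = 9 (|A|+|B|+|C|) √(1 + ν⁻¹)`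
(`AbcCrayaMatrix.norm_abcCrayaMatrix_le`), band-comparable weights `L = √(2(1+ν))` and Schur data
`R₀ = C₀ = W K/√x₀ < 1` (instab3 g3 `SkewCutGalerkinLattice`); (A6) synthesis
(`AbcCrayaMatrix.isLinNSEigenvalue_abcFlow_of_craya_eigen'`). What is LEFT as hypotheses is exactly
the certificate side: normalised section eigenpairs of `[ℓ_i δ_ij + A_ij]` in `[a, e]` on a monotone
exhausting family of finite index sets with a uniform graph bound ((A3): `SkewCutSchurCoercivity` +
`SkewCutGalerkinBounds` after section identification), and Theorem 1′(a) injectivity at the two ends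
((A4)). CONCLUSION: a classical eigenvalue `2πλ`, `λ ∈ (a, e)`, of the unit-torus linearisation about
`Torus.abcFlow A B C` with viscosity `ν/(2π)` (`Torus.IsLinNSEigenvalue`). The class-II version
((A5), the certified object) needs the same statement on the class-II subspace; this file is the
class-free dry run of the hypothesis shapes.

§8 adds the (A4) PAIRING input in these coordinates: for every finitely supported coordinate family
`∑_i conj(v_i)(A v)_i = ∑_k ⟪c(k), X c(k)⟫` (`c = crayaSynth v`; `sum_conj_mul_abcCrayaMatrix_eq`), hence
`|Re ∑_i conj(v_i)(A v)_i| ≤ √2 ∑_i |v_i|²` for `abcFlow 1 1 1` (`abs_re_sum_conj_mul_abcCrayaMatrix_le`,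
transporting implementation 2's Cartesian bound `AbcLatticePairingBound.abs_re_sum_inner_crossForm_le`):
the numerical range of every finite section of the certifier's advective matrix has real part in
`[−√2, √2]` (INSTAB3-METHOD §2 self-test S2, now a theorem). Mathlib + tree files only; no definitions.
-/

noncomputable section

open scoped BigOperators InnerProductSpace ComplexConjugate Matrix
open Finset Matrix Filter Topology

namespace Summit.NavierStokesRegularity.FluidComputer.AbcCrayaAssembly

open Literature.Analysis.FluidPDE Literature.Analysis.FluidPDE.SteadyLattice
open Literature.Analysis.FunctionSpaces Literature.Analysis.FunctionSpaces.Torus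
open Summit.NavierStokesRegularity.FluidComputer.CrayaFrames
open Summit.NavierStokesRegularity.FluidComputer.AbcCrayaMatrix

/-! ### §7 ASSEMBLY for the full (class-free) operator in Craya coordinates

The abstract X0 chain `SkewCutGalerkinFromSections.exists_smooth_eigenvector_Ioo_of_sections'`
instantiated on the Craya index set with the certifier's matrix: every STRUCTURAL hypothesis (levels,
resolvent symbol identities, band, band width `W = 12`, first-order growth `K`, band-comparable
weights `L`, weight/symbol product `M = 1/√x₀`, Schur data `R₀ = C₀ = W K M < 1`) is discharged here;
what remains are exactly the CERTIFICATE-SIDE inputs — normalised section eigenpairs in `[a, e]` with a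
uniform graph bound (SkewCutSchurCoercivity + SkewCutGalerkinBounds after section identification) and
Theorem 1′(a) injectivity at the two ends — and the conclusion is a classical eigenvalue `2πλ`,
`λ ∈ (a, e)`, of the unit-torus linearisation about the ABC flow with viscosity `ν/(2π)`. -/

/-- `⟨k⟩ ≤ √(1 + ν⁻¹) · √(1 + ν|k|²)` (`ν > 0`): the first-order weight against the chain's weight
`w = √(1 + |ℓ|)`, `ℓ = −ν|k|²`. -/
theorem sobolevWeight_le_sqrt_mul (k : Fin 3 → ℤ) {ν : ℝ} (hν : 0 < ν) :
    sobolevWeight 1 k ≤ Real.sqrt (1 + ν⁻¹) * Real.sqrt (1 + |-(ν * freqNormSq k)|) := by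
  have hx : 0 ≤ freqNormSq k := freqNormSq_nonneg k
  have habs : |-(ν * freqNormSq k)| = ν * freqNormSq k := by
    rw [abs_neg, abs_of_nonneg (mul_nonneg hν.le hx)]
  rw [habs, ← Real.sqrt_mul (by positivity), sobolevWeight, ← Real.sqrt_eq_rpow]
  apply Real.sqrt_le_sqrt
  have h1 : ν⁻¹ * (ν * freqNormSq k) = freqNormSq k := by
    rw [← mul_assoc, inv_mul_cancel₀ hν.ne', one_mul]
  nlinarith [inv_pos.mpr hν, mul_nonneg hν.le hx]

/-- **ASSEMBLY (full operator, Craya coordinates).** See the section docstring. `b` is ANY Hilbert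
basis indexed by the Craya index set of ANY Hilbert space `H` (e.g. `ℓ²(CrayaIdx)` with its canonical
basis): only the coordinates `⟪b i, v⟫` of the abstract eigenvector are used. Constants:
`K = 9 (|A| + |B| + |C|) √(1 + ν⁻¹)` (growth, `norm_abcCrayaMatrix_le`), `W = 12` (`card_crayaNbr_le`),
`L = √(2(1 + ν))` (`SkewCutGalerkinLattice.weight_le_of_neighbour`), `M = 1/√x₀`
(`SkewCutGalerkinLattice.weight_mul_symbol_le`), any base point `x₀ ≥ 1` with `(12 K)² < x₀`, and the
resolvent symbol `d_i = (x₀ + ν|k_i|²)⁻¹` (`SkewCutGalerkinWeights.exists_resolventSymbol`).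
MODEL statement; not NS; no certificate is used or moved here. -/
theorem exists_isLinNSEigenvalue_abcFlow_of_craya_sections (A B C : ℝ) {ν : ℝ} (hν : 0 < ν)
    {H : Type*} [NormedAddCommGroup H] [InnerProductSpace ℂ H] [CompleteSpace H]
    (b : HilbertBasis CrayaIdx ℂ H)
    -- base point and resolvent symbol
    (x₀ : ℝ) (hx₀ : 1 ≤ x₀)
    (hxK : (12 * (9 * (|A| + |B| + |C|) * Real.sqrt (1 + ν⁻¹))) ^ 2 < x₀)
    (d : lp (fun _ : CrayaIdx => ℂ) ⊤)
    (hdform : ∀ i : CrayaIdx, d i = (((x₀ - -(ν * freqNormSq i.1.1))⁻¹ : ℝ) : ℂ))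
    (hd : ∀ i : CrayaIdx, d i * ((x₀ : ℂ) - ((-(ν * freqNormSq i.1.1) : ℝ) : ℂ)) = 1)
    (hd0 : Tendsto (fun i => ‖d i‖) cofinite (𝓝 0))
    -- certificate side: normalised section eigenpairs in `[a, e]` with a uniform graph bound
    (F : ℕ → Finset CrayaIdx) (hF : Monotone F) (hFex : ∀ i, ∃ n, i ∈ F n)
    (c : ℕ → CrayaIdx → ℂ) (xs : ℕ → ℝ) {a e : ℝ} (hxs : ∀ n, xs n ∈ Set.Icc a e)
    (heig : ∀ n, ∀ i ∈ F n, ((-(ν * freqNormSq i.1.1) : ℝ) : ℂ) * c n i +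
      ∑ j ∈ F n, abcCrayaMatrix A B C i j * c n j = (xs n : ℂ) * c n i)
    (hnorm : ∀ n, ∑ j ∈ F n, ‖c n j‖ ^ 2 = 1) {Cg : ℝ} (hCg : 0 ≤ Cg)
    (hgraph : ∀ n, ∑ j ∈ F n, ‖((x₀ : ℂ) - ((-(ν * freqNormSq j.1.1) : ℝ) : ℂ)) * c n j‖ ^ 2 ≤ Cg ^ 2)
    -- certificate side: Theorem 1′(a) at the two ends, for the operator with matrix `A_ij d_j`
    (hinj : ∀ T : H →L[ℂ] H, (∀ i j, ⟪b i, T (b j)⟫_ℂ = abcCrayaMatrix A B C i j * d j) →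
      (∀ x i, ⟪b i, T x⟫_ℂ = ∑' j, (abcCrayaMatrix A B C i j * d j) * ⟪b j, x⟫_ℂ) →
      (∀ (x : H) i, Summable fun j => (abcCrayaMatrix A B C i j * d j) * ⟪b j, x⟫_ℂ) →
      (∀ T' : H →L[ℂ] H, (∀ i j, ⟪b i, T' (b j)⟫_ℂ = abcCrayaMatrix A B C i j * d j) → T' = T) →
      (∀ w, ((1 : H →L[ℂ] H) - T - ((x₀ : ℂ) - (a : ℂ)) • b.diagonalCLM d) w = 0 → w = 0) ∧
      (∀ w, ((1 : H →L[ℂ] H) - T - ((x₀ : ℂ) - (e : ℂ)) • b.diagonalCLM d) w = 0 → w = 0)) :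
    ∃ lam ∈ Set.Ioo a e,
      Torus.IsLinNSEigenvalue (ν / (2 * Real.pi)) (Torus.abcFlow A B C) (2 * Real.pi * lam) := by
  classical
  -- levels and finiteness of cube fibres
  set ℓ : CrayaIdx → ℝ := fun i => -(ν * freqNormSq i.1.1) with hℓdef
  have hℓ0 : ∀ i, ℓ i ≤ 0 := fun i => by
    rw [hℓdef]; exact neg_nonpos.mpr (mul_nonneg hν.le (freqNormSq_nonneg _))
  -- the matrix of the relative bound
  set t : CrayaIdx → CrayaIdx → ℂ := fun i j => abcCrayaMatrix A B C i j * d j with htdef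
  have htA : ∀ i j, t i j * ((x₀ : ℂ) - (ℓ j : ℂ)) = abcCrayaMatrix A B C i j := fun i j => by
    rw [htdef]; dsimp only; rw [mul_assoc, hd j, mul_one]
  have ht0 : ∀ i j, j ∉ crayaNbr i → t i j = 0 := fun i j hj => by
    rw [htdef]; dsimp only; rw [abcCrayaMatrix_eq_zero_of_not_mem A B C hj, zero_mul]
  -- weights
  set wgt : CrayaIdx → ℝ := fun i => Real.sqrt (1 + |ℓ i|) with hwgtdef
  have hw0 : ∀ i, 0 ≤ wgt i := fun i => Real.sqrt_nonneg _
  have hwℓ : ∀ i, wgt i ^ 2 ≤ 1 + |ℓ i| := fun i => by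
    rw [hwgtdef]; dsimp only; rw [Real.sq_sqrt (by positivity)]
  -- growth `‖A_ij‖ ≤ K w_j`
  set S : ℝ := |A| + |B| + |C| with hS
  set K : ℝ := 9 * S * Real.sqrt (1 + ν⁻¹) with hKdef
  have hS0 : 0 ≤ S := by rw [hS]; positivity
  have hK : 0 ≤ K := by rw [hKdef]; positivity
  have ha : ∀ i j, j ∈ crayaNbr i → ‖t i j * ((x₀ : ℂ) - (ℓ j : ℂ))‖ ≤ K * wgt j := by
    intro i j _
    rw [htA]
    calc ‖abcCrayaMatrix A B C i j‖ ≤ 9 * S * sobolevWeight 1 j.1.1 := norm_abcCrayaMatrix_le A B C i j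
      _ ≤ 9 * S * (Real.sqrt (1 + ν⁻¹) * wgt j) :=
          mul_le_mul_of_nonneg_left (sobolevWeight_le_sqrt_mul j.1.1 hν) (by positivity)
      _ = K * wgt j := by rw [hKdef]; ring
  -- band-comparable weights
  have hL : ∀ i j, j ∈ crayaNbr i → wgt i ≤ Real.sqrt (2 * (1 + ν)) * wgt j := by
    intro i j hj
    have hq : ∑ m, (((i.1.1 m : ℤ) : ℝ) - ((j.1.1 m : ℤ) : ℝ)) ^ 2 ≤ 1 := by
      have h := freqNormSq_sub_of_mem_crayaNbr hj
      rw [freqNormSq] at h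
      simp only [Pi.sub_apply, Int.cast_sub] at h
      exact h.le
    have h := SkewCutGalerkinLattice.weight_le_of_neighbour hν.le i.1.1 j.1.1 hq
    simpa only [hwgtdef, hℓdef, freqNormSq] using h
  -- weight/symbol product `M = 1/√x₀`
  have hM : ∀ i, ‖d i‖ * wgt i ≤ 1 / Real.sqrt x₀ := by
    intro i
    have hpos : 0 < x₀ - ℓ i := by linarith [hℓ0 i]
    have hn : ‖d i‖ = (x₀ - ℓ i)⁻¹ := by
      rw [hdform i, Complex.norm_real, Real.norm_eq_abs, abs_of_pos (inv_pos.mpr hpos)]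
    rw [hn]
    exact SkewCutGalerkinLattice.weight_mul_symbol_le (hℓ0 i) hx₀
  -- Schur data
  have hq12 : ((12 : ℕ) : ℝ) * K * (1 / Real.sqrt x₀) < 1 := by
    have hx0 : 0 < x₀ := by linarith
    have hsx : 0 < Real.sqrt x₀ := Real.sqrt_pos.mpr hx0
    have h12K : 0 ≤ 12 * K := by positivity
    have hlt : 12 * K < Real.sqrt x₀ := by
      rw [← Real.sqrt_sq h12K, hKdef]
      exact Real.sqrt_lt_sqrt (sq_nonneg _) hxK
    rw [Nat.cast_ofNat, mul_one_div, div_lt_one hsx]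
    exact hlt
  obtain ⟨hrow, hR, hcol, hC₀, hR0, hq⟩ :=
    SkewCutGalerkinLattice.schur_data_of_band t ℓ x₀ d hd crayaNbr mem_crayaNbr_comm card_crayaNbr_le
      ht0 wgt hK (by positivity) ha hM hq12
  -- section eigen-equations in the chain's form
  have heig' : ∀ n, ∀ i ∈ F n, (ℓ i : ℂ) * c n i +
      ∑ j ∈ F n, (t i j * ((x₀ : ℂ) - (ℓ j : ℂ))) * c n j = (xs n : ℂ) * c n i := by
    intro n i hi
    simp_rw [htA]
    exact heig n i hi
  -- run the abstract chain
  obtain ⟨T, -, -, lam, hlam, v, hv1, heigv, hreg⟩ :=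
    SkewCutGalerkinFromSections.exists_smooth_eigenvector_Ioo_of_sections' b ℓ x₀ d hd hd0 t hrow hR hcol
      hC₀ hR0 hR0 hq crayaNbr mem_crayaNbr_comm card_crayaNbr_le ht0 wgt hw0 hwℓ hK ha
      (Real.sqrt_nonneg _) hL hM F hF hFex c xs hxs heig' hnorm hCg hgraph hinj
  refine ⟨lam, hlam, ?_⟩
  -- the coordinates of `v` solve the certifier's eigen-equation with all weights
  set w : CrayaIdx → ℂ := fun i => ⟪b i, v⟫_ℂ with hwdef
  have hwne : w ≠ 0 := by
    intro hw
    have hv0 : v = 0 := by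
      apply b.repr.injective
      rw [map_zero]
      ext i
      rw [b.repr_apply_apply]
      exact congr_fun hw i
    rw [hv0, norm_zero] at hv1
    exact zero_ne_one hv1
  have hreg' : ∀ s : ℕ, Summable fun i : CrayaIdx => (1 + ν * freqNormSq i.1.1) ^ s * ‖w i‖ ^ 2 := by
    intro s
    refine (hreg s).congr fun i => ?_
    have habs : |ℓ i| = ν * freqNormSq i.1.1 := by
      rw [hℓdef]; dsimp only
      rw [abs_neg, abs_of_nonneg (mul_nonneg hν.le (freqNormSq_nonneg _))]
    rw [hwgtdef]; dsimp only
    rw [pow_mul, Real.sq_sqrt (by positivity), habs]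
  refine isLinNSEigenvalue_abcFlow_of_craya_eigen' A B C hν hwne hreg' fun i => ?_
  have e2 : ∑ j ∈ crayaNbr i, abcCrayaMatrix A B C i j * w j =
      ∑ j ∈ crayaNbr i, (t i j * ((x₀ : ℂ) - (ℓ j : ℂ))) * ⟪b j, v⟫_ℂ :=
    Finset.sum_congr rfl fun j _ => by rw [htA]
  have hℓi : ((ℓ i : ℝ) : ℂ) = -(((ν * freqNormSq i.1.1 : ℝ)) : ℂ) := by
    rw [hℓdef]; dsimp only; push_cast; ring
  rw [e2, ← hℓi]
  exact heigv i

/-! ### §8 The pairing of the certifier's matrix in Craya coordinates = the Cartesian pairing;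
### the (F1)+(F2) bound `s = √2` for every finitely supported coordinate family -/

/-- Inner products against a synthesised vector: `⟪c(k), X⟫ = ∑_a conj(v(k,a)) ⟪e_a(k), X⟫` (`k ≠ 0`). -/
theorem inner_crayaSynth_left (v : CrayaIdx → ℂ) {k : Fin 3 → ℤ} (hk : k ≠ 0)
    (X : EuclideanSpace ℂ (Fin 3)) :
    ⟪crayaSynth v k, X⟫_ℂ = ∑ a, conj (v (⟨k, hk⟩, a)) * ⟪crayaVec a k, X⟫_ℂ := by
  rw [crayaSynth_of_ne_zero v hk, sum_inner]
  exact Finset.sum_congr rfl fun a _ => by rw [inner_smul_left]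

/-- The synthesis of a family supported in `S` is supported in the frequencies of `S`. -/
theorem crayaSynth_eq_zero_of_not_mem_image (v : CrayaIdx → ℂ) (S : Finset CrayaIdx)
    (hvS : ∀ i ∉ S, v i = 0) {k : Fin 3 → ℤ} (hk : k ∉ S.image fun i => i.1.1) : crayaSynth v k = 0 := by
  classical
  by_cases h0 : k = 0
  · subst h0; exact crayaSynth_zero_freq v
  · rw [crayaSynth_of_ne_zero v h0]
    refine Finset.sum_eq_zero fun a _ => ?_
    have : v (⟨k, h0⟩, a) = 0 := hvS _ fun hmem => hk (Finset.mem_image.mpr ⟨_, hmem, rfl⟩)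
    rw [this, zero_smul]

/-- Sums over a support set in Craya coordinates, as sums over frequencies and frame labels. -/
theorem sum_support_eq_sum_image (v : CrayaIdx → ℂ) (S : Finset CrayaIdx) (hvS : ∀ i ∉ S, v i = 0)
    (g : CrayaIdx → ℂ → ℂ) (hg : ∀ i, g i 0 = 0) :
    ∑ i ∈ S, g i (v i) = ∑ k ∈ (S.image fun i => i.1.1),
      if h : k = 0 then 0 else ∑ a, g (⟨k, h⟩, a) (v (⟨k, h⟩, a)) := by
  classical
  -- enlarge `S` to the product of its frequency image (as a subtype finset) with `Fin 2`
  set T : Finset {k : Fin 3 → ℤ // k ≠ 0} := (S.image fun i => i.1.1).subtype fun k => k ≠ 0 with hT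
  set G : (Fin 3 → ℤ) → ℂ := fun k => if h : k = 0 then 0 else ∑ a, g (⟨k, h⟩, a) (v (⟨k, h⟩, a)) with hG
  have hsub : S ⊆ T ×ˢ Finset.univ := by
    intro i hi
    rw [Finset.mem_product, hT, Finset.mem_subtype]
    exact ⟨Finset.mem_image.mpr ⟨i, hi, rfl⟩, Finset.mem_univ _⟩
  rw [Finset.sum_subset hsub (fun i _ hi => by rw [hvS i hi, hg]), Finset.sum_product]
  have h1 : ∑ x ∈ T, ∑ a, g (x, a) (v (x, a)) = ∑ x ∈ T, G x.1 :=
    Finset.sum_congr rfl fun x _ => by rw [hG]; dsimp only; rw [dif_neg x.2]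
  rw [h1, hT, Finset.sum_subtype_eq_sum_filter, Finset.sum_filter]
  refine Finset.sum_congr rfl fun k _ => ?_
  by_cases hk : k = 0
  · rw [if_neg (not_not.mpr hk), hG]; dsimp only; rw [dif_pos hk]
  · rw [if_pos hk]

/-- **The pairing in Craya coordinates IS the Cartesian pairing.** For a coordinate family `v`
supported in a finite set `S`:
`∑_{i ∈ S} conj(v_i) (∑_{j ∈ band(i)} A_{ij} v_j) = ∑_{k ∈ freq(S)} ⟪c(k), X c(k)⟫`, `c = crayaSynth v`,
`X c(k) = ∑_y â(q_y) × (i (k−q_y) × c(k−q_y) − c(k−q_y))`. -/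
theorem sum_conj_mul_abcCrayaMatrix_eq (A B C : ℝ) (v : CrayaIdx → ℂ) (S : Finset CrayaIdx)
    (hvS : ∀ i ∉ S, v i = 0) :
    ∑ i ∈ S, conj (v i) * ∑ j ∈ crayaNbr i, abcCrayaMatrix A B C i j * v j =
      ∑ k ∈ (S.image fun i => i.1.1), ⟪crayaSynth v k, ∑ y : Fin 3 × Bool,
        WithLp.toLp 2 (WithLp.ofLp (Torus.abcCoeff A B C (Torus.abcDir y)) ⨯₃
          (Complex.I • ((fun m : Fin 3 => (((k - Torus.abcDir y) m : ℤ) : ℂ)) ⨯₃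
            WithLp.ofLp (crayaSynth v (k - Torus.abcDir y))) -
            WithLp.ofLp (crayaSynth v (k - Torus.abcDir y))))⟫_ℂ := by
  rw [sum_support_eq_sum_image v S hvS (fun i z => conj z * ∑ j ∈ crayaNbr i, abcCrayaMatrix A B C i j * v j)
    (fun i => by simp)]
  refine Finset.sum_congr rfl fun k _ => ?_
  by_cases hk : k = 0
  · subst hk; simp [crayaSynth_zero_freq]
  · simp only [hk, dif_neg, not_false_eq_true]
    rw [inner_crayaSynth_left v hk]
    refine Finset.sum_congr rfl fun a _ => ?_
    rw [sum_abcCrayaMatrix_mul_eq_inner]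

/-- Square norms in Craya coordinates are square norms of the synthesised family:
`∑_{i ∈ S} |v_i|² = ∑_{k ∈ freq(S)} ‖c(k)‖²` for `v` supported in `S`. -/
theorem sum_norm_sq_eq (v : CrayaIdx → ℂ) (S : Finset CrayaIdx) (hvS : ∀ i ∉ S, v i = 0) :
    ∑ i ∈ S, ((‖v i‖ ^ 2 : ℝ) : ℂ) = ∑ k ∈ (S.image fun i => i.1.1), ((‖crayaSynth v k‖ ^ 2 : ℝ) : ℂ) := by
  rw [sum_support_eq_sum_image v S hvS (fun _ z => ((‖z‖ ^ 2 : ℝ) : ℂ)) (fun i => by simp)]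
  refine Finset.sum_congr rfl fun k _ => ?_
  by_cases hk : k = 0
  · subst hk; simp [crayaSynth_zero_freq]
  · simp only [hk, dif_neg, not_false_eq_true]
    rw [norm_sq_crayaSynth v hk]
    push_cast
    rfl

/-- **(A4)(F1)+(F2) in Craya coordinates: the numerical range of every finite section of the
certifier's matrix for `abcFlow 1 1 1` has real part in `[−√2, √2]`.** For every coordinate family `v`
supported in a finite set `S`:
`|Re ∑_{i ∈ S} conj(v_i) (∑_j A_{ij} v_j)| ≤ √2 ∑_{i ∈ S} |v_i|²` — implementation 2's Cartesian pairing
bound `AbcLatticePairingBound.abs_re_sum_inner_crossForm_le` (instab4 g5) transported to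
implementation 1's coordinates; the constant `s = √2` of the skew-cut certificates (`hpair` of
`SkewCutGalerkinTailForm.not_eigenvalue_of_structure` on sections). -/
theorem abs_re_sum_conj_mul_abcCrayaMatrix_le (v : CrayaIdx → ℂ) (S : Finset CrayaIdx)
    (hvS : ∀ i ∉ S, v i = 0) :
    |(∑ i ∈ S, conj (v i) * ∑ j ∈ crayaNbr i, abcCrayaMatrix 1 1 1 i j * v j).re| ≤
      Real.sqrt 2 * ∑ i ∈ S, ‖v i‖ ^ 2 := by
  classical
  have hsupp : ∀ k ∉ S.image (fun i => i.1.1), crayaSynth v k = 0 :=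
    fun k hk => crayaSynth_eq_zero_of_not_mem_image v S hvS hk
  have h := AbcLatticePairingBound.abs_re_sum_inner_crossForm_le (crayaSynth v) (S.image fun i => i.1.1) hsupp
    (kdot_crayaSynth v)
  have hsq : ∑ i ∈ S, ‖v i‖ ^ 2 = ∑ k ∈ (S.image fun i => i.1.1), ‖crayaSynth v k‖ ^ 2 := by
    have := sum_norm_sq_eq v S hvS
    exact_mod_cast this
  rw [sum_conj_mul_abcCrayaMatrix_eq 1 1 1 v S hvS, hsq]
  simp_rw [Torus.sum_abcFreq] at h
  exact h

end Summit.NavierStokesRegularity.FluidComputer.AbcCrayaAssembly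

end
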